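import Mathlib
import Literature.Barriers.ValiantsHypothesis.AlgebraicNaturalProofs
import Summits.ValiantsHypothesis.ValiantsHypothesis.Theorems.BarrierLeverPartitionMinorsHitByVPAutomorphicLayouts
import Summits.ValiantsHypothesis.ValiantsHypothesis.Theorems.BarrierLeverPartitionMinorsHitByVPCorankRepair
import Summits.ValiantsHypothesis.ValiantsHypothesis.Theorems.BarrierLeverPartitionMinorsHitByVPStratifiedLayouts

/-!
# Route BarrierLever — item `PartitionMinorsHitByVP` (stmt-ValiantsHypothesis-19717):
# NEAR-AUTOMORPHIC layouts (poly(h) defects) and strata of near-automorphic cells are hit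

Helper file (`--supports stmt-ValiantsHypothesis-19717`; cell valiant-natproofs, rung V4, 𝒟-side,
prover seat val-np-p6 gen 0). Definition-free. Closes NO item.

The automorphic class (`…Automorphic.partitionMinor_hit_of_automorphic`, p437176) is rigid: the
columns must be EXACTLY the image of the rows under one cube automorphism. Combining it with the
corank repair of prover gen 6 (`…CorankRepair.hit_of_corank_le`, p434564) makes it ROBUST: at the
twisted diagonal state `f_{(σ,s)}` the layout matrix is the partial permutation matrix
`[w j = σ((u i) ∆ s)]`, whose rank is the number of rows whose image IS a column
(`rank_ge_of_matched`); if at most `(h+h)^c` rows are DEFECTIVE (image not a column) the corank is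
`≤ (h+h)^c` and the repair lands a witness in `SmallCircuits ℂ (h+h) (c+3)`.

* `rank_ge_of_matched` — a lower bound for the rank of the layout matrix at the twisted state.
* **`partitionMinor_hit_of_nearAutomorphic`** (UNCONDITIONAL CLASS) — `≤ (h+h)^c` defective rows
  ⇒ hit inside `SmallCircuits ℂ (h+h) (c+3)` (`h ≥ 1`); `c`-defect version of p437176, and the
  automorphic version of `…ProductStateSums.partitionMinor_hit_of_few_unmatched` (p431204, `σ = 1`,
  `s = ∅`).
* `cell_hit_of_nearAutomorphic` — the same for a CELL (a stratum `{i // lr i = t}` with columns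
  `e i'`), by reindexing the stratum to `Fin n`.
* **`partitionMinor_hit_of_nearAutomorphicStrata`** (UNCONDITIONAL CLASS) — `m ≤ (h+h)^c` strata of
  one threshold pair, any matching, EVERY stratum near-automorphic under its own cube automorphism
  with `≤ (h+h)^c` defects ⇒ hit inside `SmallCircuits ℂ (h+h) (2c+4)` — the strata door fed with
  repaired (non-product, non-monomial) cell witnesses.

WHAT THIS IS NOT: structured classes with poly(h) slack; nothing on generic layouts of the middle
band, on TT / item 19616, on crux 14610 or on VP vs VNP.
-/

set_option linter.dupNamespace false

namespace Summit.ValiantsHypothesis.ValiantsHypothesis.Theorems.BarrierLever.StrataDoor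

open Finset
open Literature.Barriers.ValiantsHypothesis Literature.Computability.AlgebraicComplexity
open Summit.ValiantsHypothesis.ValiantsHypothesis.Theorems.BarrierLever.Automorphic
  (coeff_twistedDiag twistedDiag_mem_smallCircuits)
open Summit.ValiantsHypothesis.ValiantsHypothesis.Theorems.BarrierLever.CorankRepair (hit_of_corank_le)
open Summit.ValiantsHypothesis.ValiantsHypothesis.Theorems.BarrierLever.SplitDoor (smallCircuits_mono)

variable {h r : ℕ}

/-! ## 1. Rank of the layout matrix at the twisted diagonal state -/

/-- At the twisted diagonal state of `(σ, s)` the layout matrix has rank at least the number of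
MATCHED rows (rows `i` with `σ((u i) ∆ s)` a column). -/
theorem rank_ge_of_matched (u w : Fin r → Finset (Fin h)) (hu : Function.Injective u)
    (σ : Equiv.Perm (Fin h)) (s : Finset (Fin h)) :
    (Finset.univ.filter (fun i : Fin r => ∃ j, w j = (symmDiff (u i) s).image σ)).card ≤
      (Matrix.of fun i j : Fin r => MvPolynomial.coeff
        (∑ a ∈ u i, Finsupp.single (Fin.castAdd h a) 1 +
          ∑ c ∈ w j, Finsupp.single (Fin.natAdd h c) 1)
        (∏ a : Fin h, (if a ∈ s then MvPolynomial.X (Fin.natAdd h (σ a)) + MvPolynomial.X (Fin.castAdd h a)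
          else 1 + MvPolynomial.X (Fin.castAdd h a) * MvPolynomial.X (Fin.natAdd h (σ a))) :
          MvPolynomial (Fin (h + h)) ℂ)).rank := by
  classical
  set A : Finset (Fin r) := Finset.univ.filter (fun i : Fin r => ∃ j, w j = (symmDiff (u i) s).image σ)
    with hA
  set M : Matrix (Fin r) (Fin r) ℂ := Matrix.of fun i j : Fin r => MvPolynomial.coeff
        (∑ a ∈ u i, Finsupp.single (Fin.castAdd h a) 1 +
          ∑ c ∈ w j, Finsupp.single (Fin.natAdd h c) 1)
        (∏ a : Fin h, (if a ∈ s then MvPolynomial.X (Fin.natAdd h (σ a)) + MvPolynomial.X (Fin.castAdd h a)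
          else 1 + MvPolynomial.X (Fin.castAdd h a) * MvPolynomial.X (Fin.natAdd h (σ a))) :
          MvPolynomial (Fin (h + h)) ℂ) with hM
  have hmemA : ∀ i, i ∈ A ↔ ∃ j, w j = (symmDiff (u i) s).image σ := fun i => by simp [hA]
  have hinj : ∀ X Y : Finset (Fin h), (symmDiff X s).image σ = (symmDiff Y s).image σ ↔ X = Y := by
    intro X Y
    constructor
    · intro hXY
      have h1 : symmDiff X s = symmDiff Y s := (Finset.image_injective σ.injective) hXY
      simpa [symmDiff_left_inj] using congrArg (fun C => symmDiff C s) h1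
    · rintro rfl
      rfl
  -- the matched column of a matched row
  have hch : ∀ i : {i // i ∈ A}, ∃ j, w j = (symmDiff (u i.1) s).image σ := fun i => (hmemA i.1).mp i.2
  choose jm hjm using hch
  have hsub : M.submatrix (Subtype.val : {i // i ∈ A} → Fin r) jm = 1 := by
    ext i i'
    rw [Matrix.submatrix_apply, hM, Matrix.of_apply, coeff_twistedDiag, hjm i', Matrix.one_apply]
    simp only [hinj, hu.eq_iff]
    by_cases hii : i = i'
    · subst hii; simp
    · rw [if_neg (fun hh => hii (Subtype.ext hh).symm), if_neg hii]
  have h1 := Matrix.rank_submatrix_le M (Subtype.val : {i // i ∈ A} → Fin r) jm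
  rw [hsub, Matrix.rank_one, Fintype.card_coe] at h1
  exact h1

/-! ## 2. Near-automorphic layouts -/

/-- **Near-automorphic layouts are hit** (`b = c + 3`, `h ≥ 1`): if at most `(h+h)^c` rows `i` are
defective (`σ((u i) ∆ s)` is not a column), the layout matrix of item 19717 is nonsingular at some
`f ∈ SmallCircuits ℂ (h+h) (c+3)`. -/
theorem partitionMinor_hit_of_nearAutomorphic (c : ℕ) (hh : 1 ≤ h) (u w : Fin r → Finset (Fin h))
    (hu : Function.Injective u) (hw : Function.Injective w) (σ : Equiv.Perm (Fin h))
    (s : Finset (Fin h))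
    (hdef : (Finset.univ.filter (fun i : Fin r => ∀ j, w j ≠ (symmDiff (u i) s).image σ)).card ≤
      (h + h) ^ c) :
    ∃ f ∈ SmallCircuits ℂ (h + h) (c + 3),
      (Matrix.of fun i j : Fin r => MvPolynomial.coeff
        (∑ a ∈ u i, Finsupp.single (Fin.castAdd h a) 1 +
          ∑ c ∈ w j, Finsupp.single (Fin.natAdd h c) 1) f).det ≠ 0 := by
  classical
  have hsplit := Finset.card_filter_add_card_filter_not (s := (Finset.univ : Finset (Fin r)))
    (fun i : Fin r => ∃ j, w j = (symmDiff (u i) s).image σ)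
  have hnot : (Finset.univ.filter (fun i : Fin r => ¬ ∃ j, w j = (symmDiff (u i) s).image σ)) =
      Finset.univ.filter (fun i : Fin r => ∀ j, w j ≠ (symmDiff (u i) s).image σ) := by
    ext i; simp
  rw [hnot, Finset.card_univ, Fintype.card_fin] at hsplit
  have hrank := rank_ge_of_matched u w hu σ s
  obtain ⟨f, hf, hdet⟩ := hit_of_corank_le 2 c hh u w hu hw _ (twistedDiag_mem_smallCircuits hh σ s)
    (by omega)
  refine ⟨f, smallCircuits_mono (by omega) ?_ hf, hdet⟩
  rw [max_eq_right (by omega)]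

/-- **Near-automorphic CELL.** For a stratum `{i // lr i = t}` with columns `e i'`: if at most
`(h+h)^c` of its rows are defective (their image under `(σ, s)` is not a column OF THE CELL), some
`g ∈ SmallCircuits ℂ (h+h) (c+3)` has a nonsingular cell matrix (`h ≥ 1`). -/
theorem cell_hit_of_nearAutomorphic (c : ℕ) (hh : 1 ≤ h) (u w : Fin r → Finset (Fin h))
    (hu : Function.Injective u) (hw : Function.Injective w) (lr : Fin r → ℕ)
    (e : Equiv.Perm (Fin r)) (t : ℕ) (σ : Equiv.Perm (Fin h)) (s : Finset (Fin h))
    (hdef : (Finset.univ.filter (fun i : {i // lr i = t} =>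
      ∀ i' : {i // lr i = t}, w (e i'.1) ≠ (symmDiff (u i.1) s).image σ)).card ≤ (h + h) ^ c) :
    ∃ g ∈ SmallCircuits ℂ (h + h) (c + 3), (Matrix.of fun i i' : {i // lr i = t} =>
      MvPolynomial.coeff (∑ a ∈ u i.1, Finsupp.single (Fin.castAdd h a) 1 +
        ∑ c ∈ w (e i'.1), Finsupp.single (Fin.natAdd h c) 1) g).det ≠ 0 := by
  classical
  set n := Fintype.card {i // lr i = t} with hn
  let q : {i // lr i = t} ≃ Fin n := Fintype.equivFin _
  set u' : Fin n → Finset (Fin h) := fun k => u (q.symm k).1 with hu'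
  set w' : Fin n → Finset (Fin h) := fun k => w (e (q.symm k).1) with hw'
  have hu'i : Function.Injective u' := fun k k' hk =>
    q.symm.injective (Subtype.ext (hu hk))
  have hw'i : Function.Injective w' := fun k k' hk =>
    q.symm.injective (Subtype.ext (e.injective (hw hk)))
  have hdef' : (Finset.univ.filter (fun k : Fin n => ∀ k', w' k' ≠ (symmDiff (u' k) s).image σ)).card ≤
      (h + h) ^ c := by
    refine le_trans ?_ hdef
    rw [← Finset.card_map q.symm.toEmbedding]
    apply Finset.card_le_card
    intro i hi
    rw [Finset.mem_map] at hi
    obtain ⟨k, hk, rfl⟩ := hi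
    rw [Finset.mem_filter] at hk ⊢
    refine ⟨Finset.mem_univ _, fun i' => ?_⟩
    have := hk.2 (q i')
    simpa [hw', hu'] using this
  obtain ⟨g, hg, hdet⟩ := partitionMinor_hit_of_nearAutomorphic c hh u' w' hu'i hw'i σ s hdef'
  refine ⟨g, hg, ?_⟩
  have hre : (Matrix.of fun i i' : {i // lr i = t} => MvPolynomial.coeff
      (∑ a ∈ u i.1, Finsupp.single (Fin.castAdd h a) 1 +
        ∑ c ∈ w (e i'.1), Finsupp.single (Fin.natAdd h c) 1) g) =
      (Matrix.of fun k k' : Fin n => MvPolynomial.coeff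
        (∑ a ∈ u' k, Finsupp.single (Fin.castAdd h a) 1 +
          ∑ c ∈ w' k', Finsupp.single (Fin.natAdd h c) 1) g).reindex q.symm q.symm := by
    ext i i'
    simp only [Matrix.reindex_apply, Matrix.submatrix_apply, Matrix.of_apply, Equiv.symm_symm, hu', hw',
      Equiv.symm_apply_apply]
  rw [hre, Matrix.det_reindex_self]
  exact hdet

/-! ## 3. Strata of near-automorphic cells -/

/-- **Strata of near-automorphic cells are hit** (`b = 2c + 4`, `h ≥ 1`): `m ≤ (h+h)^c` strata of one
threshold pair, matched by `π` along `e`, stratum `t` near-automorphic under its own `(σ t, S t)`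
with at most `(h+h)^c` defective rows. -/
theorem partitionMinor_hit_of_nearAutomorphicStrata (c m : ℕ) (hh : 1 ≤ h) (hm : m ≤ (h + h) ^ c)
    (u w : Fin r → Finset (Fin h)) (hu : Function.Injective u) (hw : Function.Injective w)
    (lam mu : Fin h → ℤ) (lr lc : Fin r → ℕ) (π : ℕ → ℕ) (e : Equiv.Perm (Fin r))
    (he : ∀ i, lc (e i) = π (lr i)) (hπ : ∀ i j : Fin r, π (lr i) = π (lr j) → lr i = lr j)
    (hlr : ∀ i, lr i < m) (cr cc : ℕ → ℤ) (hcr : Monotone cr) (hcc : Monotone cc)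
    (hrow : ∀ i, cr (lr i) < ∑ a ∈ u i, lam a ∧ ∑ a ∈ u i, lam a ≤ cr (lr i + 1))
    (hcol : ∀ j, cc (lc j) < ∑ c ∈ w j, mu c ∧ ∑ c ∈ w j, mu c ≤ cc (lc j + 1))
    (σ : ℕ → Equiv.Perm (Fin h)) (S : ℕ → Finset (Fin h))
    (hdef : ∀ t < m, (Finset.univ.filter (fun i : {i // lr i = t} =>
      ∀ i' : {i // lr i = t}, w (e i'.1) ≠ (symmDiff (u i.1) (S t)).image (σ t))).card ≤ (h + h) ^ c) :
    ∃ f ∈ SmallCircuits ℂ (h + h) (2 * c + 4),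
      (Matrix.of fun i j : Fin r => MvPolynomial.coeff
        (∑ a ∈ u i, Finsupp.single (Fin.castAdd h a) 1 +
          ∑ c ∈ w j, Finsupp.single (Fin.natAdd h c) 1) f).det ≠ 0 := by
  classical
  have hex : ∀ t, ∃ g : MvPolynomial (Fin (h + h)) ℂ, t < m →
      (g ∈ SmallCircuits ℂ (h + h) (c + 3) ∧ (Matrix.of fun i i' : {i // lr i = t} =>
        MvPolynomial.coeff (∑ a ∈ u i.1, Finsupp.single (Fin.castAdd h a) 1 +
          ∑ c ∈ w (e i'.1), Finsupp.single (Fin.natAdd h c) 1) g).det ≠ 0) := by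
    intro t
    by_cases ht : t < m
    · obtain ⟨g, hg, hd⟩ := cell_hit_of_nearAutomorphic c hh u w hu hw lr e t (σ t) (S t) (hdef t ht)
      exact ⟨g, fun _ => ⟨hg, hd⟩⟩
    · exact ⟨0, fun h' => absurd h' ht⟩
  choose F hF using hex
  obtain ⟨f, hdeg, hsize, hne⟩ := partitionMinor_hit_of_strata_perm m u w lam mu lr lc π e he hπ hlr
    cr cc hcr hcc hrow hcol F (fun t ht => (hF t ht).2)
  refine ⟨f, ⟨?_, ?_⟩, hne⟩
  · exact hdeg.trans (Finset.sup_le fun t ht => (hF t (Finset.mem_range.mp ht)).1.1)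
  · refine hsize.trans ?_
    calc ∑ t ∈ Finset.range m, complexity (F t) + m * (h + h + 2)
        ≤ ∑ _t ∈ Finset.range m, (h + h) ^ (c + 3) + m * (h + h + 2) := by
          gcongr with t ht
          exact (hF t (Finset.mem_range.mp ht)).1.2
      _ = m * ((h + h) ^ (c + 3) + (h + h) + 2) := by
          rw [Finset.sum_const, Finset.card_range, smul_eq_mul]; ring
      _ ≤ (h + h) ^ (c + (c + 3) + 1) := strata_budget c (c + 3) m hh (by omega) hm
      _ = (h + h) ^ (2 * c + 4) := by ring_nf

end Summit.ValiantsHypothesis.ValiantsHypothesis.Theorems.BarrierLever.StrataDoor
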